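import Summits.NavierStokesRegularity.NavierStokesRegularity.Theorems.ExtremiserTransienceNearExtremalTransienceExtremiserLiouvilleConstantSpeedSlideGradientL4General
import Summits.NavierStokesRegularity.NavierStokesRegularity.Theorems.ExtremiserTransienceNearExtremalTransienceExtremiserLiouvilleConstantSpeedSlideLayerWeight
import HarnessLib

/-!
# Crux `ExtremiserTransience.NearExtremalTransience` (stmt-NavierStokesRegularity-21883), line `extremiser_liouville`,
# stub K1b — THE QUARTIC-GRADIENT LINE OF R6b FOR THE LAYER-STEP WEIGHT (record §18)

`--supports stmt-NavierStokesRegularity-21883` (helper).  Author: prover seat `ns-el-k1b` (g9).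

The weighted `L⁴` interpolation `…ConstantSpeedSlideGradientL4General.integral_axialWeight_frobeniusNormSq_sq_le_general` specialised to
the layer weight `γ = g′_{a,L}`, `g_{a,L}(s) = H((s − a)/L)` of `…ConstantSpeedSlideLayerWeight` (`L > 0`; any `a`), for a field `V`
with `‖DV‖ ≤ B`, `DV, D²V ∈ L²` and `‖V‖ ≤ σ` on the far region `{|x₂| ≥ a}` (`…SlideJetKinematics.exists_forall_norm_le_of_le_abs_coord_two`):
```
  ∫ g′_{a,L}(x₂)|DV|⁴_F ≤ 4σB ∫ |g″_{a,L}(x₂)|·|DV|²_F + 108σ² ∫ g′_{a,L}(x₂)‖D²V‖²      (|g″_{a,L}| ≤ D₂/L², supported in [a, a+L]).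
```
* `integral_layerWeight_frobeniusNormSq_sq_le` : the displayed inequality.

WHAT THIS IS NOT: K1b is NOT proved; nothing here proves NS regularity. [folklore]
-/

noncomputable section

open Set Filter Topology MeasureTheory Metric Function InnerProductSpace
open scoped ENNReal NNReal Topology InnerProductSpace RealInnerProductSpace ContDiff
open Literature.Analysis.FluidPDE Literature.Analysis

namespace Summit.NavierStokesRegularity.NavierStokesRegularity.Theorems

-- the problem directory repeats the summit name (`NavierStokesRegularity/NavierStokesRegularity`)
set_option linter.dupNamespace false

namespace ExtremiserLiouville

open DepletionLadder.KStar

variable {V : EuclideanSpace ℝ (Fin 3) → EuclideanSpace ℝ (Fin 3)}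

/-- **The quartic-gradient line of R6b**: for `V ∈ C^∞(ℝ³;ℝ³)` with `‖DV‖ ≤ B`, `DV, D²V ∈ L²`, `‖V‖ ≤ σ` on `{|x₂| ≥ a}`,
and the layer step `g = g_{a,L}` (`L > 0`):
`∫g′(x₂)|DV|⁴_F ≤ 4σB∫|g″(x₂)|·|DV|²_F + 108σ²∫g′(x₂)‖D²V‖²`. [folklore] -/
theorem integral_layerWeight_frobeniusNormSq_sq_le (hV : ContDiff ℝ ∞ V) {B σ a L : ℝ} (hB : ∀ x, ‖fderiv ℝ V x‖ ≤ B)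
    (hL : 0 < L) (hσ0 : 0 ≤ σ) (hσ : ∀ x : EuclideanSpace ℝ (Fin 3), a ≤ |x 2| → ‖V x‖ ≤ σ)
    (i1 : Integrable (fun y => ‖fderiv ℝ V y‖ ^ 2) (volume : Measure (EuclideanSpace ℝ (Fin 3))))
    (i2 : Integrable (fun y => ‖iteratedFDeriv ℝ 2 V y‖ ^ 2) (volume : Measure (EuclideanSpace ℝ (Fin 3)))) :
    (∫ x : EuclideanSpace ℝ (Fin 3), deriv (fun s : ℝ => Real.smoothTransition ((s - a) / L)) (x 2) * frobeniusNormSq (fderiv ℝ V x) ^ 2) ≤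
      4 * σ * B * (∫ x : EuclideanSpace ℝ (Fin 3), |deriv (deriv (fun s : ℝ => Real.smoothTransition ((s - a) / L))) (x 2)| * frobeniusNormSq (fderiv ℝ V x)) +
        108 * σ ^ 2 * ∫ x : EuclideanSpace ℝ (Fin 3), deriv (fun s : ℝ => Real.smoothTransition ((s - a) / L)) (x 2) * ‖iteratedFDeriv ℝ 2 V x‖ ^ 2 := by
  obtain ⟨D₁, D₂, D₃, hD₁, hD₂, -, hD⟩ := exists_bounds_derivs_layerStep
  have hB0 : 0 ≤ B := (norm_nonneg _).trans (hB 0)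
  -- the weight `γ = g′` and its hypotheses
  have hγc : ContDiff ℝ 1 (deriv (fun s : ℝ => Real.smoothTransition ((s - a) / L))) := by
    have h : ContDiff ℝ (⊤ : ℕ∞) (deriv (fun s : ℝ => Real.smoothTransition ((s - a) / L))) := by
      simpa using (contDiff_layerStep (a := a) (L := L)).iterate_deriv 1
    exact h.of_le (by exact_mod_cast le_top)
  have hγ0 : ∀ s, 0 ≤ deriv (fun s : ℝ => Real.smoothTransition ((s - a) / L)) s := deriv_layerStep_nonneg hL
  have hγK : ∀ s, deriv (fun s : ℝ => Real.smoothTransition ((s - a) / L)) s ≤ D₁ / L := fun s => (le_abs_self _).trans (hD a L hL s).1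
  have hγ'K : ∀ s, |deriv (deriv (fun s : ℝ => Real.smoothTransition ((s - a) / L))) s| ≤ D₂ / L ^ 2 := fun s => (hD a L hL s).2.1
  -- where `g′ ≠ 0` or `g″ ≠ 0` we are on the far region `x₂ ≥ a ≥ 0`
  have hfar1 : ∀ x : EuclideanSpace ℝ (Fin 3), deriv (fun s : ℝ => Real.smoothTransition ((s - a) / L)) (x 2) ≠ 0 → ‖V x‖ ≤ σ := fun x hx => by
    refine hσ x ?_
    by_contra hlt
    have hx2 : x 2 < a := by
      have : |x 2| < a := not_le.1 hlt
      exact (le_abs_self _).trans_lt this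
    exact hx (derivs_layerStep_eq_zero hL (Or.inl hx2)).1
  have hfar2 : ∀ x : EuclideanSpace ℝ (Fin 3), deriv (deriv (fun s : ℝ => Real.smoothTransition ((s - a) / L))) (x 2) ≠ 0 → ‖V x‖ ≤ σ := fun x hx => by
    refine hσ x ?_
    by_contra hlt
    have hx2 : x 2 < a := by
      have : |x 2| < a := not_le.1 hlt
      exact (le_abs_self _).trans_lt this
    exact hx (derivs_layerStep_eq_zero hL (Or.inl hx2)).2.1
  -- the general interpolation inequality
  have hmain := integral_axialWeight_frobeniusNormSq_sq_le_general hV hγc hγ0 hγK hγ'K hσ0 hfar1 hB i1 i2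
  -- bound the weight-derivative term: `|g″|·|DV|²_F·Σ|⟪V,∂ₖV⟫| ≤ 3σB·|g″|·|DV|²_F`
  have nb : ∀ k : Fin 3, ‖EuclideanSpace.basisFun (Fin 3) ℝ k‖ = 1 := fun k => (EuclideanSpace.basisFun (Fin 3) ℝ).orthonormal.norm_eq_one k
  have nu : ∀ (k : Fin 3) (x : EuclideanSpace ℝ (Fin 3)), ‖fderiv ℝ V x (EuclideanSpace.basisFun (Fin 3) ℝ k)‖ ≤ ‖fderiv ℝ V x‖ := fun k x => by
    simpa [nb k] using (fderiv ℝ V x).le_opNorm (EuclideanSpace.basisFun (Fin 3) ℝ k)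
  have hF0 : ∀ x : EuclideanSpace ℝ (Fin 3), 0 ≤ frobeniusNormSq (fderiv ℝ V x) := fun x => frobeniusNormSq_nonneg _
  have hFle : ∀ x : EuclideanSpace ℝ (Fin 3), frobeniusNormSq (fderiv ℝ V x) ≤ 3 * ‖fderiv ℝ V x‖ ^ 2 := fun x => by
    rw [frobeniusNormSq_eq_sum (EuclideanSpace.basisFun (Fin 3) ℝ)]
    have := sum_sq_norm_apply_le_card_mul_sq_opNorm (EuclideanSpace.basisFun (Fin 3) ℝ) (fderiv ℝ V x)
    rwa [Fintype.card_fin, Nat.cast_ofNat] at this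
  have hpt : ∀ x : EuclideanSpace ℝ (Fin 3), |deriv (deriv (fun s : ℝ => Real.smoothTransition ((s - a) / L))) (x 2)| * (frobeniusNormSq (fderiv ℝ V x) * ∑ k : Fin 3, |⟪V x, fderiv ℝ V x (EuclideanSpace.basisFun (Fin 3) ℝ k)⟫|) ≤
      3 * σ * B * (|deriv (deriv (fun s : ℝ => Real.smoothTransition ((s - a) / L))) (x 2)| * frobeniusNormSq (fderiv ℝ V x)) := fun x => by
    by_cases h0 : deriv (deriv (fun s : ℝ => Real.smoothTransition ((s - a) / L))) (x 2) = 0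
    · rw [h0, abs_zero]; simp
    have hVσ := hfar2 x h0
    have hS : ∑ k : Fin 3, |⟪V x, fderiv ℝ V x (EuclideanSpace.basisFun (Fin 3) ℝ k)⟫| ≤ 3 * σ * B := by
      have hk : ∀ k : Fin 3, |⟪V x, fderiv ℝ V x (EuclideanSpace.basisFun (Fin 3) ℝ k)⟫| ≤ σ * B := fun k =>
        (abs_real_inner_le_norm _ _).trans (mul_le_mul hVσ ((nu k x).trans (hB x)) (norm_nonneg _) hσ0)
      calc ∑ k : Fin 3, |⟪V x, fderiv ℝ V x (EuclideanSpace.basisFun (Fin 3) ℝ k)⟫| ≤ ∑ k : Fin 3, σ * B := Finset.sum_le_sum fun k _ => hk k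
        _ = 3 * σ * B := by simp; ring
    have h1 := mul_le_mul_of_nonneg_left hS (mul_nonneg (abs_nonneg (deriv (deriv (fun s : ℝ => Real.smoothTransition ((s - a) / L))) (x 2))) (hF0 x))
    calc |deriv (deriv (fun s : ℝ => Real.smoothTransition ((s - a) / L))) (x 2)| * (frobeniusNormSq (fderiv ℝ V x) * ∑ k : Fin 3, |⟪V x, fderiv ℝ V x (EuclideanSpace.basisFun (Fin 3) ℝ k)⟫|)
        = (|deriv (deriv (fun s : ℝ => Real.smoothTransition ((s - a) / L))) (x 2)| * frobeniusNormSq (fderiv ℝ V x)) * ∑ k : Fin 3, |⟪V x, fderiv ℝ V x (EuclideanSpace.basisFun (Fin 3) ℝ k)⟫| := by ring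
      _ ≤ (|deriv (deriv (fun s : ℝ => Real.smoothTransition ((s - a) / L))) (x 2)| * frobeniusNormSq (fderiv ℝ V x)) * (3 * σ * B) := h1
      _ = 3 * σ * B * (|deriv (deriv (fun s : ℝ => Real.smoothTransition ((s - a) / L))) (x 2)| * frobeniusNormSq (fderiv ℝ V x)) := by ring
  -- integrability of both sides of the pointwise bound
  have cγ' : Continuous fun x : EuclideanSpace ℝ (Fin 3) => deriv (deriv (fun s : ℝ => Real.smoothTransition ((s - a) / L))) (x 2) :=
    (hγc.continuous_deriv le_rfl).comp (EuclideanSpace.proj (2 : Fin 3) : EuclideanSpace ℝ (Fin 3) →L[ℝ] ℝ).continuous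
  have cF : Continuous fun x : EuclideanSpace ℝ (Fin 3) => frobeniusNormSq (fderiv ℝ V x) := continuous_frobeniusNormSq_fderiv hV (by simp)
  have cu : ∀ k : Fin 3, Continuous fun x : EuclideanSpace ℝ (Fin 3) => fderiv ℝ V x (EuclideanSpace.basisFun (Fin 3) ℝ k) := fun k =>
    ((hV.fderiv_right (m := ∞) (by exact_mod_cast le_rfl)).clm_apply contDiff_const).continuous
  have iR : Integrable (fun x : EuclideanSpace ℝ (Fin 3) => |deriv (deriv (fun s : ℝ => Real.smoothTransition ((s - a) / L))) (x 2)| * frobeniusNormSq (fderiv ℝ V x)) volume := by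
    refine (i1.const_mul (D₂ / L ^ 2 * 3)).mono' ((continuous_abs.comp cγ').mul cF).aestronglyMeasurable (Eventually.of_forall fun x => ?_)
    rw [Real.norm_eq_abs, abs_of_nonneg (mul_nonneg (abs_nonneg _) (hF0 x))]
    calc |deriv (deriv (fun s : ℝ => Real.smoothTransition ((s - a) / L))) (x 2)| * frobeniusNormSq (fderiv ℝ V x) ≤ D₂ / L ^ 2 * (3 * ‖fderiv ℝ V x‖ ^ 2) :=
          mul_le_mul (hγ'K _) (hFle x) (hF0 x) (div_nonneg hD₂ (pow_pos hL 2).le)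
      _ = D₂ / L ^ 2 * 3 * ‖fderiv ℝ V x‖ ^ 2 := by ring
  have iL : Integrable (fun x : EuclideanSpace ℝ (Fin 3) => |deriv (deriv (fun s : ℝ => Real.smoothTransition ((s - a) / L))) (x 2)| *
      (frobeniusNormSq (fderiv ℝ V x) * ∑ k : Fin 3, |⟪V x, fderiv ℝ V x (EuclideanSpace.basisFun (Fin 3) ℝ k)⟫|)) volume := by
    refine (iR.const_mul (3 * σ * B)).mono' ((continuous_abs.comp cγ').mul (cF.mul (continuous_finsetSum _ fun k _ =>
      (hV.continuous.inner (cu k)).abs))).aestronglyMeasurable (Eventually.of_forall fun x => ?_)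
    rw [Real.norm_eq_abs, abs_of_nonneg (mul_nonneg (abs_nonneg _) (mul_nonneg (hF0 x) (Finset.sum_nonneg fun k _ => abs_nonneg _)))]
    exact hpt x
  have hmono : (∫ x : EuclideanSpace ℝ (Fin 3), |deriv (deriv (fun s : ℝ => Real.smoothTransition ((s - a) / L))) (x 2)| * (frobeniusNormSq (fderiv ℝ V x) * ∑ k : Fin 3, |⟪V x, fderiv ℝ V x (EuclideanSpace.basisFun (Fin 3) ℝ k)⟫|)) ≤
      3 * σ * B * ∫ x : EuclideanSpace ℝ (Fin 3), |deriv (deriv (fun s : ℝ => Real.smoothTransition ((s - a) / L))) (x 2)| * frobeniusNormSq (fderiv ℝ V x) := by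
    rw [← integral_const_mul]
    exact integral_mono iL (iR.const_mul _) hpt
  linarith [hmain, hmono]

end ExtremiserLiouville

end Summit.NavierStokesRegularity.NavierStokesRegularity.Theorems

end
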